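import Literature.AlgebraicGeometry.Resolution.LogRegularDimensionBound
import HarnessLib

/-!
# Log regular charts under base change with units (Kato 1994, (10.3): general points of the chart)

`Literature/AlgebraicGeometry/Resolution/LogRegularBaseChange.lean`. In the proof of K. Kato,
*Toric singularities*, Amer. J. Math. 116 (1994), (10.3), a point `x′` of the refined chart
`X ×_{ℤ[P]} ℤ[Q]` over `x ∈ X` need not be the origin of the chart: the coordinates belonging to
the face `G` of `Q` of elements invertible at `x′` take unit values, and `x′` is the origin of the
chart over the local ring `A₁ = (A[G^{gp}])_𝔮` of the torus fibre, with the chart twisted by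
units, `φ₁(p) = φ(p)·u(p)⁻¹`. This file isolates the ABSTRACT base-change step: the d-form
hypotheses of `LogRegularRefinementAbsorb`/`LogRegularDimensionBound` (`𝔪_A = (φ(P ∖ 0)) + (t)`,
`rank P + d ≤ dim A`) pass from `A` to a Noetherian local `A`-algebra `A₁` with
`𝔪_{A₁} = 𝔪_A A₁ + (t″₁,…,t″_h)` and `dim A + h ≤ dim A₁`, for the twisted chart `φ₁ = f ∘ φ · u⁻¹`
(`u : P → A₁ˣ` multiplicative); hence Kato (10.3) holds at the closed point of the refined chart
over `A₁`.

* `twistChart` — `φ₁(p) = f(φ p) · ↑(u p)⁻¹`;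
* `dform_baseChange` — the hypotheses transfer;
* `isRegularLocalRing_localization_closedPoint_baseChange` — Kato (10.3) at the origin over `A₁`.

References: [Kato1994] K. Kato, Toric singularities, Amer. J. Math. 116 (1994), (10.3), (2.1).
-/

noncomputable section

open IsLocalRing Literature.RingTheory.MvPowerSeries
  Literature.RingTheory.MvPowerSeries.monoidPowerSeries

namespace Literature.AlgebraicGeometry.Resolution

namespace LogRegularCompleteStructure

universe u

variable {A : Type u} [CommRing A] [IsLocalRing A] [IsNoetherianRing A]
  {A₁ : Type u} [CommRing A₁] [IsLocalRing A₁] [IsNoetherianRing A₁]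
  {M N d h : ℕ} {P : AddSubmonoid (Fin M →₀ ℕ)} {φ : (Fin M →₀ ℕ) → A}

/-- **The twisted chart** over an `A`-algebra: `φ₁(p) = f(φ p) · u(p)⁻¹` for units `u(p)`.
[cite: Kato1994, (10.3)] -/
def twistChart (f : A →+* A₁) (φ : (Fin M →₀ ℕ) → A) (u : (Fin M →₀ ℕ) → A₁ˣ)
    (p : Fin M →₀ ℕ) : A₁ :=
  f (φ p) * ↑(u p)⁻¹

omit [IsLocalRing A] [IsNoetherianRing A] [IsLocalRing A₁] [IsNoetherianRing A₁] in
/-- The twisted chart is multiplicative. [cite: Kato1994, (10.3)] -/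
theorem twistChart_add (f : A →+* A₁) {u : (Fin M →₀ ℕ) → A₁ˣ}
    (hφadd : ∀ a ∈ P, ∀ b ∈ P, φ (a + b) = φ a * φ b)
    (hu : ∀ a ∈ P, ∀ b ∈ P, u (a + b) = u a * u b) :
    ∀ a ∈ P, ∀ b ∈ P, twistChart f φ u (a + b) = twistChart f φ u a * twistChart f φ u b := by
  intro a ha b hb
  rw [twistChart, twistChart, twistChart, hφadd a ha b hb, hu a ha b hb, map_mul, mul_inv,
    Units.val_mul]
  ring

omit [IsLocalRing A] [IsNoetherianRing A] [IsLocalRing A₁] [IsNoetherianRing A₁] in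
/-- The twisted chart at `0`. [cite: Kato1994, (10.3)] -/
theorem twistChart_zero (f : A →+* A₁) {u : (Fin M →₀ ℕ) → A₁ˣ} (hφ0 : φ 0 = 1) (hu0 : u 0 = 1) :
    twistChart f φ u 0 = 1 := by
  rw [twistChart, hφ0, hu0, map_one, inv_one, Units.val_one, one_mul]

omit [IsNoetherianRing A] [IsNoetherianRing A₁] in
/-- A local homomorphism maps the maximal ideal into the maximal ideal. [folklore] -/
private theorem map_mem_maximalIdeal' (f : A →+* A₁) [IsLocalHom f] {a : A}
    (ha : a ∈ maximalIdeal A) : f a ∈ maximalIdeal A₁ :=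
  (mem_maximalIdeal _).2 (map_nonunit f a ((mem_maximalIdeal _).1 ha))

omit [IsNoetherianRing A] [IsNoetherianRing A₁] in
/-- The twisted chart sends `P ∖ 0` into `𝔪_{A₁}` (for a local `f`). [cite: Kato1994, (10.3)] -/
theorem twistChart_mem_maximalIdeal (f : A →+* A₁) [IsLocalHom f] {u : (Fin M →₀ ℕ) → A₁ˣ}
    (hφm : ∀ p ∈ P, p ≠ 0 → φ p ∈ maximalIdeal A) :
    ∀ p ∈ P, p ≠ 0 → twistChart f φ u p ∈ maximalIdeal A₁ := by
  intro p hp hp0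
  rw [twistChart]
  refine Ideal.mul_mem_right _ _ ?_
  exact map_mem_maximalIdeal' f (hφm p hp hp0)

omit [IsNoetherianRing A] [IsNoetherianRing A₁] in
/-- **Generation transfers**: if `𝔪_A = (φ(P ∖ 0)) + (t)` and `𝔪_{A₁} = 𝔪_A A₁ + (t″)` then
`𝔪_{A₁} = (φ₁(P ∖ 0)) + (f ∘ t, t″)`. [cite: Kato1994, (10.3)] -/
theorem maximalIdeal_le_span_twistChart (f : A →+* A₁) {u : (Fin M →₀ ℕ) → A₁ˣ} {t : Fin d → A}
    {t'' : Fin h → A₁}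
    (hgen : maximalIdeal A ≤ Ideal.span (φ '' {p | p ∈ P ∧ p ≠ 0}) ⊔ Ideal.span (Set.range t))
    (hgen₁ : maximalIdeal A₁ ≤ (maximalIdeal A).map f ⊔ Ideal.span (Set.range t'')) :
    maximalIdeal A₁ ≤ Ideal.span (twistChart f φ u '' {p | p ∈ P ∧ p ≠ 0}) ⊔
      Ideal.span (Set.range (Fin.append (f ∘ t) t'')) := by
  have hft : ∀ k, f (t k) ∈ Ideal.span (Set.range (Fin.append (f ∘ t) t'')) := fun k =>
    Ideal.subset_span ⟨Fin.castAdd h k, by rw [Fin.append_left]; rfl⟩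
  have ht'' : ∀ k, t'' k ∈ Ideal.span (Set.range (Fin.append (f ∘ t) t'')) := fun k =>
    Ideal.subset_span ⟨Fin.natAdd d k, by rw [Fin.append_right]⟩
  refine hgen₁.trans (sup_le ?_ (Ideal.span_le.2 ?_))
  · rw [Ideal.map_le_iff_le_comap]
    refine hgen.trans (sup_le ?_ ?_)
    · rw [Ideal.span_le]
      rintro _ ⟨p, ⟨hp, hp0⟩, rfl⟩
      rw [SetLike.mem_coe, Ideal.mem_comap]
      have hφ1 : f (φ p) = twistChart f φ u p * ↑(u p) := by
        rw [twistChart, mul_assoc, Units.inv_mul, mul_one]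
      rw [hφ1]
      exact Ideal.mem_sup_left (Ideal.mul_mem_right _ _ (Ideal.subset_span ⟨p, ⟨hp, hp0⟩, rfl⟩))
    · rw [Ideal.span_le]
      rintro _ ⟨k, rfl⟩
      rw [SetLike.mem_coe, Ideal.mem_comap]
      exact Ideal.mem_sup_right (hft k)
  · rintro _ ⟨k, rfl⟩
    exact Ideal.mem_sup_right (ht'' k)

omit [IsNoetherianRing A] in
/-- **Kato 1994, (10.3) at the origin of the chart over a base change with units.** Let `A` be a
Noetherian local ring with d-form chart data (`φ : P → A`, `t : Fin d → 𝔪_A`,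
`𝔪_A = (φ(P ∖ 0)) + (t)`, `rank P + d ≤ dim A`), `f : A → A₁` a local homomorphism to a
Noetherian local ring with `𝔪_{A₁} = 𝔪_A A₁ + (t″₁..t″_h)` and `dim A + h ≤ dim A₁` (e.g. the local
ring of the torus fibre `(A[S^{±1}])_𝔮` at a point over `𝔪_A`), `u : P → A₁ˣ` multiplicative
(the unit values of the face coordinates), and `c : P → ℕ^N` a refinement. Then the refined chart
of the absorbed twisted chart `φ₁ = f∘φ·u⁻¹` over `A₁` is regular of dimension `N + d + h` at
its closed point. [cite: Kato1994, (10.3)] -/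
theorem isRegularLocalRing_localization_closedPoint_baseChange
    (f : A →+* A₁) [IsLocalHom f] {u : (Fin M →₀ ℕ) → A₁ˣ} {t : Fin d → A} {t'' : Fin h → A₁}
    {c : (Fin M →₀ ℕ) → (Fin N →₀ ℕ)} (hP : P.FG)
    (hφ0 : φ 0 = 1) (hφadd : ∀ a ∈ P, ∀ b ∈ P, φ (a + b) = φ a * φ b)
    (hφm : ∀ p ∈ P, p ≠ 0 → φ p ∈ maximalIdeal A) (ht : ∀ k, t k ∈ maximalIdeal A)
    (hgen : maximalIdeal A ≤ Ideal.span (φ '' {p | p ∈ P ∧ p ≠ 0}) ⊔ Ideal.span (Set.range t))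
    (hdim : ((rank P + d : ℕ) : WithBot ℕ∞) ≤ ringKrullDim A)
    (hu0 : u 0 = 1) (hu : ∀ a ∈ P, ∀ b ∈ P, u (a + b) = u a * u b)
    (ht'' : ∀ k, t'' k ∈ maximalIdeal A₁)
    (hgen₁ : maximalIdeal A₁ ≤ (maximalIdeal A).map f ⊔ Ideal.span (Set.range t''))
    (hdim₁ : ringKrullDim A + h ≤ ringKrullDim A₁)
    (hc0 : c 0 = 0) (hadd : ∀ a ∈ P, ∀ b ∈ P, c (a + b) = c a + c b)
    (hc : ∀ p ∈ P, p ≠ 0 → c p ≠ 0)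
    (hfin : ∀ e : Fin N →₀ ℕ, {p : Fin M →₀ ℕ | p ∈ P ∧ c p = e}.Finite) :
    letI := isMaximal_closedPoint (P := absorbMonoid P (d + h))
      (absorbChart_zero (twistChart_zero f hφ0 hu0) (Fin.append (f ∘ t) t''))
      (absorbChart_mem_maximalIdeal (twistChart_mem_maximalIdeal f hφm) (t := Fin.append (f ∘ t) t'')
        (fun k => by
          induction k using Fin.addCases with
          | left k => rw [Fin.append_left]; exact map_mem_maximalIdeal' f (ht k)
          | right k => rw [Fin.append_right]; exact ht'' k))
      (absorbMap_zero (d := d + h) hc0) (absorbMap_ne_zero hc)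
    IsRegularLocalRing (Localization.AtPrime (closedPoint (absorbChart (twistChart f φ u)
        (Fin.append (f ∘ t) t'')) (absorbMap c) (absorbMonoid P (d + h))
        (absorbChart_zero (twistChart_zero f hφ0 hu0) (Fin.append (f ∘ t) t''))
        (absorbChart_mem_maximalIdeal (twistChart_mem_maximalIdeal f hφm)
          (t := Fin.append (f ∘ t) t'') (fun k => by
            induction k using Fin.addCases with
            | left k => rw [Fin.append_left]; exact map_mem_maximalIdeal' f (ht k)
            | right k => rw [Fin.append_right]; exact ht'' k))
        (absorbMap_zero (d := d + h) hc0) (absorbMap_ne_zero hc))) := by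
  have htt : ∀ k, Fin.append (f ∘ t) t'' k ∈ maximalIdeal A₁ := fun k => by
    induction k using Fin.addCases with
    | left k => rw [Fin.append_left]; exact map_mem_maximalIdeal' f (ht k)
    | right k => rw [Fin.append_right]; exact ht'' k
  have hdim' : ((rank P + (d + h) : ℕ) : WithBot ℕ∞) ≤ ringKrullDim A₁ := by
    refine le_trans ?_ hdim₁
    calc ((rank P + (d + h) : ℕ) : WithBot ℕ∞) = ((rank P + d : ℕ) : WithBot ℕ∞) + h := by
          push_cast; ring
      _ ≤ ringKrullDim A + h := add_le_add hdim le_rfl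
  exact (isRegularLocalRing_localization_closedPoint_of_le hP
    (twistChart_zero f hφ0 hu0) (twistChart_add f hφadd hu) (twistChart_mem_maximalIdeal f hφm) htt
    (maximalIdeal_le_span_twistChart f hgen hgen₁) hdim' hc0 hadd hc hfin).1

end LogRegularCompleteStructure

end Literature.AlgebraicGeometry.Resolution
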